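import Literature.AlgebraicGeometry.ComplexMultiplication.EndomorphismFieldSignatureCondition
import HarnessLib

/-!
# The reflex degree under a signature: `[K* : ℚ] ≤ C(n, a) + C(n, n − a)` in the complex model and on Shimura's pair
# (Dodson 1984: `[K′ : ℚ] = |G·Φ|`, «the `G`-orbit of `f` is `G₀*(f) ∪ G₀*(ρf)`»); sharp for the special types

Topic `Literature/AlgebraicGeometry/ComplexMultiplication` (family `hodge`, lane `lit-hodgefound`; the ALGEBRAIC
carrier `Motives.AbelianVariety ℂ`, Shimura's pairs `(A, ι : F →+* A.endAlgebra)`, `[F : ℚ] = 2 dim A`, THE type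
`Φ = cmTypeOfPair ι hF`; §1 is at the level of CM types of a CM field `K ⊇ k₀`).  Sequel of
`NumberTheory/ComplexMultiplication/CMTypeSignatureGaloisClasses` (p11 g26-#2: the `ψ`-multiplicity of a Galois
conjugate is `a` or `n − a`; a type is determined by its `ψ`-trace), `CMTypeGaloisClassReflexDegree`
(`#(Galois class) = [K* : ℚ]` in the complex model) and `EndomorphismFieldSignatureCondition` (p11 g26-#3).  The tree
proves the bound `[K′ : ℚ] ≤ C(n,a) + C(n,b)` in the `(W)`/`(W_L)` models
(`ReflexDegreeQuadraticSubfieldBound.finrank_reflexField_le_choose_add_choose_of_ringHom`, reflex field inside a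
Galois closure `L`); this file gives it for the complex reflex field `traceField Φ = ℚ(tr_Φ) ⊂ ℂ` and reads it on the
pair under the `(r, s)`-signature condition.

PRINTED STATEMENTS.  B. Dodson, *The structure of Galois groups of CM-fields*, Trans. AMS 283 (1984) [Dodson1984]
(held `paper:doi-10-2307-1999987`), §1.3 Remark (p. 5): «Note that `[K′ : ℚ]` is also the order of the orbit of `Φ`
under the `G`-action»; §3.1.1 Theorem, proof (p. 12): «the `G`-orbit of `f` is `G₀*(f) ∪ G₀*(ρf)` […] the weight
`w = weight(v)` is constant for `v ∈ G₀*(f)`».  Consequently the orbit injects into the vectors of weight `w` or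
`n − w` in `(ℤ₂)ⁿ`: `[K′ : ℚ] ≤ C(n, w) + C(n, n − w)`, and `≤ C(n, w)` when `2w = n`.  G. Shimura (1998)
[Shimura1998] §8.3 Prop. 28 (`K* = ℚ(tr_Φ)`).  B. Howard (2012) [Howard2012] §3.1 (`K_Φ = φ^sp(K)`, so the special
types attain `2n = C(n,1) + C(n,n−1)`).

WHAT IS PROVED.

* §1 (type level; `K` a CM field, `k₀ ≤ K` imaginary quadratic, `ψ : k₀ → ℂ`, `a` = the `ψ`-multiplicity of `Φ` as
  `{φ | φ ∈ Φ.1 ∧ φ.comp (algebraMap k₀ K) = ψ}.ncard`, `n = [K : k₀]`): `natCard_galoisClass_le_ncard_traces` (the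
  Galois class injects, by `Ψ ↦ Ψ ∩ F_ψ`, into the subsets of the `ψ`-fibre of size `a` or `n − a`),
  **`natCard_galoisClass_le_choose_add_choose`** (`#class ≤ C(n,a) + C(n,n−a)`),
  `natCard_galoisClass_le_choose_of_two_mul_eq` (balanced: `≤ C(n,a)`), **`finrank_traceField_le_choose_add_choose`**
  (`[K* : ℚ] ≤ C(n,a) + C(n,n−a)`), `finrank_traceField_le_choose_of_two_mul_eq`,
  `finrank_traceField_eq_choose_add_choose_of_special` (sharpness: `= 2n` for the special types, `[K : ℚ] ≥ 6`).
* §2 (pair level, `F` CM) **`finrank_traceField_cmTypeOfPair_le_choose_add_choose`** (`[K* : ℚ] ≤ C(n, m_ψ) +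
  C(n, m_ψ̄)`, `n = dim A`), **`finrank_traceField_cmTypeOfPair_le_of_charpoly_eq`** (under the `(r, s)`-signature
  condition: `≤ C(n,r) + C(n,s)`), `finrank_traceField_cmTypeOfPair_le_choose_of_card_fibre_eq` /
  `…_le_choose_of_charpoly_eq` (balanced `(r, r)`: `≤ C(2r, r)`),
  `finrank_traceField_cmTypeOfPair_eq_two_mul_dim_of_charpoly_eq` (`(1, n−1)`, `n ≥ 3`: `= 2n = C(n,1) + C(n,n−1)`).

Theorems only; no definition, no named fact, no `sorry` (net debt 0); axioms `propext`, `Classical.choice`,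
`Quot.sound`.

## References
* [Dodson1984] B. Dodson, *The structure of Galois groups of CM-fields*, Trans. AMS 283 (1984), §1.3 Remark (p. 5),
  §3.1.0–3.1.1 (pp. 11–12).
* [Shimura1998] G. Shimura, *Abelian Varieties with Complex Multiplication and Modular Functions* (1998), §8.3 Prop. 28.
* [Howard2012] B. Howard, Ann. of Math. (2) 176 (2012), §3.1.
* [KudlaRapoport2013] S. Kudla, M. Rapoport, J. reine angew. Math. 697 (2014), §2 (2.1).
* [vanGeemen1994HodgeAV] B. van Geemen, LNM 1594 (1994), 4.9.

## Provenance

Lane `lit-hodgefound` (HOME `run/shared/lean/pub/lit-hodgefound/`), prover seat `lit-hodgefound-p11` (gen 26),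
self-proposed row g26-#7 (INBOX claim 2026-08-27).
-/

noncomputable section

namespace Literature.AlgebraicGeometry.ComplexMultiplication

open scoped Manifold Classical nonZeroDivisors Polynomial
open CategoryTheory NumberField Module Polynomial
open Literature.AlgebraicGeometry.Motives
open Literature.AlgebraicGeometry.HodgeTheory
open Literature.NumberTheory.ComplexMultiplication

/-! ### §1 Type level: the Galois class of `Φ` injects into the subsets of the `ψ`-fibre of size `a` or `n − a` -/

section TypeLevel

variable {K : Type} [Field K] [NumberField K] [IsCMField K] (k₀ : IntermediateField ℚ K) [IsTotallyComplex k₀]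

/-- **The Galois class of `Φ` injects into `{S ⊆ F_ψ : |S| ∈ {a, n − a}}`** by `Ψ ↦ Ψ ∩ F_ψ` («the `G`-orbit of `f`
is `G₀*(f) ∪ G₀*(ρf)`»: a conjugate has `ψ`-multiplicity `a` or `n − a`, and is determined by its `ψ`-trace).
[cite: Dodson1984, §3.1.1 Theorem (proof, p. 12) and §1.3 Remark] -/
theorem natCard_galoisClass_le_ncard_traces (hk₀ : finrank ℚ k₀ = 2) (Φ : CMType K) (ψ : k₀ →+* ℂ) :
    Nat.card {Ψ : CMType K // (cmTypeGaloisSetoid K).r Φ Ψ} ≤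
      {S : Set (K →+* ℂ) | S ⊆ {φ : K →+* ℂ | φ.comp (algebraMap k₀ K) = ψ} ∧
        (S.ncard = {φ : K →+* ℂ | φ ∈ Φ.1 ∧ φ.comp (algebraMap k₀ K) = ψ}.ncard ∨
          S.ncard = finrank k₀ K - {φ : K →+* ℂ | φ ∈ Φ.1 ∧ φ.comp (algebraMap k₀ K) = ψ}.ncard)}.ncard := by
  set T : Set (Set (K →+* ℂ)) := {S : Set (K →+* ℂ) | S ⊆ {φ : K →+* ℂ | φ.comp (algebraMap k₀ K) = ψ} ∧
      (S.ncard = {φ : K →+* ℂ | φ ∈ Φ.1 ∧ φ.comp (algebraMap k₀ K) = ψ}.ncard ∨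
        S.ncard = finrank k₀ K - {φ : K →+* ℂ | φ ∈ Φ.1 ∧ φ.comp (algebraMap k₀ K) = ψ}.ncard)} with hT
  let f : {Ψ : CMType K // (cmTypeGaloisSetoid K).r Φ Ψ} → ↥T := fun Ψ =>
    ⟨{φ : K →+* ℂ | φ ∈ Ψ.1.1 ∧ φ.comp (algebraMap k₀ K) = ψ}, fun _ hφ => hφ.2, by
      obtain ⟨τ, hτ⟩ := Ψ.2
      rw [hτ]
      exact ncard_inter_fibre_cmTypeSmul_eq_or k₀ hk₀ τ Φ ψ⟩
  have hf : Function.Injective f := fun Ψ Ψ' h =>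
    Subtype.ext (eq_of_inter_fibre_eq k₀ hk₀ ψ (congrArg Subtype.val h))
  rw [← Nat.card_coe_set_eq T]
  haveI : Finite ↥T := Subtype.finite
  exact Nat.card_le_card_of_injective f hf

omit [IsCMField K] [IsTotallyComplex k₀] in
/-- `#{S ⊆ F_ψ : |S| ∈ {a, b}} ≤ C(n, a) + C(n, b)`. [folklore] -/
private theorem ncard_traces_le (ψ : k₀ →+* ℂ) (a b : ℕ) :
    {S : Set (K →+* ℂ) | S ⊆ {φ : K →+* ℂ | φ.comp (algebraMap k₀ K) = ψ} ∧ (S.ncard = a ∨ S.ncard = b)}.ncard ≤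
      (finrank k₀ K).choose a + (finrank k₀ K).choose b := by
  have hfin : {φ : K →+* ℂ | φ.comp (algebraMap k₀ K) = ψ}.Finite := Set.toFinite _
  have hunion : {S : Set (K →+* ℂ) | S ⊆ {φ : K →+* ℂ | φ.comp (algebraMap k₀ K) = ψ} ∧ (S.ncard = a ∨ S.ncard = b)} =
      {S : Set (K →+* ℂ) | S ⊆ {φ : K →+* ℂ | φ.comp (algebraMap k₀ K) = ψ} ∧ S.ncard = a} ∪
        {S : Set (K →+* ℂ) | S ⊆ {φ : K →+* ℂ | φ.comp (algebraMap k₀ K) = ψ} ∧ S.ncard = b} := by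
    ext S
    simp only [Set.mem_setOf_eq, Set.mem_union]
    tauto
  rw [hunion]
  refine (Set.ncard_union_le _ _).trans ?_
  rw [Set.ncard_powerset_ncard hfin a, Set.ncard_powerset_ncard hfin b, ncard_fibre_eq_finrank k₀ ψ]

omit [IsCMField K] [IsTotallyComplex k₀] in
/-- `#{S ⊆ F_ψ : |S| = a} = C(n, a)`. [cite: Dodson1984, §3.1.0 (p. 11)] -/
private theorem ncard_traces_eq (ψ : k₀ →+* ℂ) (a : ℕ) :
    {S : Set (K →+* ℂ) | S ⊆ {φ : K →+* ℂ | φ.comp (algebraMap k₀ K) = ψ} ∧ (S.ncard = a ∨ S.ncard = a)}.ncard =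
      (finrank k₀ K).choose a := by
  have hfin : {φ : K →+* ℂ | φ.comp (algebraMap k₀ K) = ψ}.Finite := Set.toFinite _
  simp only [or_self]
  rw [Set.ncard_powerset_ncard hfin a, ncard_fibre_eq_finrank k₀ ψ]

/-- **`#(Galois class of Φ) ≤ C(n, a) + C(n, n − a)`**, `a` the `ψ`-multiplicity of `Φ`, `n = [K : k₀]` (Dodson:
`[K′ : ℚ] = |G·Φ|` and «the `G`-orbit of `f` is `G₀*(f) ∪ G₀*(ρf)`», the two pieces being families of `a`- and
`(n−a)`-subsets of the block; the tree's group-level form is `IsCMTypeWith.card_orbit_le_choose_add_choose`).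
[cite: Dodson1984, §3.1.1 Theorem (proof, p. 12) and §1.3 Remark (p. 5)] -/
theorem natCard_galoisClass_le_choose_add_choose (hk₀ : finrank ℚ k₀ = 2) (Φ : CMType K) (ψ : k₀ →+* ℂ) :
    Nat.card {Ψ : CMType K // (cmTypeGaloisSetoid K).r Φ Ψ} ≤
      (finrank k₀ K).choose {φ : K →+* ℂ | φ ∈ Φ.1 ∧ φ.comp (algebraMap k₀ K) = ψ}.ncard +
        (finrank k₀ K).choose (finrank k₀ K - {φ : K →+* ℂ | φ ∈ Φ.1 ∧ φ.comp (algebraMap k₀ K) = ψ}.ncard) :=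
  (natCard_galoisClass_le_ncard_traces k₀ hk₀ Φ ψ).trans (ncard_traces_le k₀ ψ _ _)

/-- **Balanced case `2a = n`: `#(Galois class of Φ) ≤ C(n, a)`** (only one family of subsets occurs).
[cite: Dodson1984, §3.1.1 Theorem (proof, p. 12) and §1.3 Remark (p. 5)] -/
theorem natCard_galoisClass_le_choose_of_two_mul_eq (hk₀ : finrank ℚ k₀ = 2) (Φ : CMType K) (ψ : k₀ →+* ℂ)
    (h : 2 * {φ : K →+* ℂ | φ ∈ Φ.1 ∧ φ.comp (algebraMap k₀ K) = ψ}.ncard = finrank k₀ K) :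
    Nat.card {Ψ : CMType K // (cmTypeGaloisSetoid K).r Φ Ψ} ≤
      (finrank k₀ K).choose {φ : K →+* ℂ | φ ∈ Φ.1 ∧ φ.comp (algebraMap k₀ K) = ψ}.ncard := by
  have key := natCard_galoisClass_le_ncard_traces k₀ hk₀ Φ ψ
  have hsub : finrank k₀ K - {φ : K →+* ℂ | φ ∈ Φ.1 ∧ φ.comp (algebraMap k₀ K) = ψ}.ncard =
      {φ : K →+* ℂ | φ ∈ Φ.1 ∧ φ.comp (algebraMap k₀ K) = ψ}.ncard := by omega
  rw [hsub, ncard_traces_eq k₀ ψ] at key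
  exact key

/-- **THE REFLEX DEGREE BOUND `[K* : ℚ] ≤ C(n, a) + C(n, n − a)`** in the complex model (`[K* : ℚ] = #(Galois class)`,
`natCard_cmTypeGaloisSetoid_class_eq_finrank_traceField`). [cite: Dodson1984, §1.3 Remark (p. 5) and §3.1.1 Theorem (proof, p. 12)]
[cite: Shimura1998, §8.3 Prop. 28] -/
theorem finrank_traceField_le_choose_add_choose (hk₀ : finrank ℚ k₀ = 2) (Φ : CMType K) (ψ : k₀ →+* ℂ) :
    finrank ℚ (traceField Φ) ≤
      (finrank k₀ K).choose {φ : K →+* ℂ | φ ∈ Φ.1 ∧ φ.comp (algebraMap k₀ K) = ψ}.ncard +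
        (finrank k₀ K).choose (finrank k₀ K - {φ : K →+* ℂ | φ ∈ Φ.1 ∧ φ.comp (algebraMap k₀ K) = ψ}.ncard) := by
  rw [← natCard_cmTypeGaloisSetoid_class_eq_finrank_traceField Φ]
  exact natCard_galoisClass_le_choose_add_choose k₀ hk₀ Φ ψ

/-- **Balanced: `[K* : ℚ] ≤ C(n, n/2)`.** [cite: Dodson1984, §1.3 Remark and §3.1.1 Theorem (proof)] [cite: Shimura1998, §8.3 Prop. 28] -/
theorem finrank_traceField_le_choose_of_two_mul_eq (hk₀ : finrank ℚ k₀ = 2) (Φ : CMType K) (ψ : k₀ →+* ℂ)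
    (h : 2 * {φ : K →+* ℂ | φ ∈ Φ.1 ∧ φ.comp (algebraMap k₀ K) = ψ}.ncard = finrank k₀ K) :
    finrank ℚ (traceField Φ) ≤ (finrank k₀ K).choose {φ : K →+* ℂ | φ ∈ Φ.1 ∧ φ.comp (algebraMap k₀ K) = ψ}.ncard := by
  rw [← natCard_cmTypeGaloisSetoid_class_eq_finrank_traceField Φ]
  exact natCard_galoisClass_le_choose_of_two_mul_eq k₀ hk₀ Φ ψ h

/-- **The bound is SHARP for the special types**: signature `(1, n − 1)`, `n ≥ 3`, gives `[K* : ℚ] = 2n = C(n, 1) + C(n, n − 1)`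
(`finrank_traceField_eq_finrank_of_special`, p11 g25-#6). [cite: Howard2012, §3.1] [cite: Dodson1984, §3.1.1 Theorem (proof)] -/
theorem finrank_traceField_eq_choose_add_choose_of_special (hk₀ : finrank ℚ k₀ = 2) (h6 : 6 ≤ finrank ℚ K)
    {Φ : CMType K} {σ₀ : K →+* ℂ} (hσ₀ : σ₀ ∈ Φ.1)
    (hsp : ∀ φ ∈ Φ.1, φ.comp (algebraMap k₀ K) = σ₀.comp (algebraMap k₀ K) → φ = σ₀) :
    finrank ℚ (traceField Φ) = (finrank k₀ K).choose 1 + (finrank k₀ K).choose (finrank k₀ K - 1) := by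
  have hn := Module.finrank_mul_finrank ℚ k₀ K
  rw [hk₀] at hn
  have h3 : 1 ≤ finrank k₀ K := by omega
  rw [finrank_traceField_eq_finrank_of_special k₀ hk₀ h6 hσ₀ hsp, Nat.choose_one_right, Nat.choose_symm h3,
    Nat.choose_one_right]
  omega

end TypeLevel

/-! ### §2 Pair level: the reflex degree of THE type under the `(r, s)`-signature condition -/

namespace EndFieldFullDegree

variable {F : Type} [Field F] [NumberField F] [IsCMField F] {A : AbelianVariety ℂ}
  (ιF : F →+* A.endAlgebra) (hF : finrank ℚ F = 2 * A.dim) (K₀ : IntermediateField ℚ F) [IsTotallyComplex K₀]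

omit [IsCMField F] [IsTotallyComplex K₀] in
/-- The multiplicity `m_ψ` as the cardinality of the `ψ`-trace. [folklore] -/
private theorem ncard_inter_fibre_eq_card₇ (Φ : CMType F) (ψ : K₀ →+* ℂ) :
    {φ : F →+* ℂ | φ ∈ Φ.1 ∧ φ.comp (algebraMap K₀ F) = ψ}.ncard =
      Fintype.card {σ : Φ.1 // σ.1.comp (algebraMap K₀ F) = ψ} := by
  rw [← Nat.card_coe_set_eq, Fintype.card_eq_nat_card]
  exact Nat.card_congr
    (Equiv.subtypeSubtypeEquivSubtypeInter (fun φ : F →+* ℂ => φ ∈ Φ.1) (fun φ => φ.comp (algebraMap K₀ F) = ψ)).symm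

omit [IsCMField F] [IsTotallyComplex K₀] in
include hF in
/-- `[F : K₀] = dim A`. [folklore] -/
private theorem finrank_eq_dim₇ (hK₀ : finrank ℚ K₀ = 2) : finrank K₀ F = A.dim := by
  have h := Module.finrank_mul_finrank ℚ K₀ F
  rw [hK₀, hF] at h
  omega

/-- **`[K* : ℚ] ≤ C(n, m_ψ) + C(n, m_ψ̄)`** for the reflex field `K*` of THE type of a pair over an imaginary quadratic
`K₀ ≤ F`, `n = dim A`. [cite: Dodson1984, §1.3 Remark and §3.1.1 Theorem (proof)] [cite: Shimura1998, §8.3 Prop. 28] -/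
theorem finrank_traceField_cmTypeOfPair_le_choose_add_choose (hK₀ : finrank ℚ K₀ = 2) (ψ : K₀ →+* ℂ) :
    finrank ℚ (traceField (cmTypeOfPair ιF hF)) ≤
      A.dim.choose (Fintype.card {σ : (cmTypeOfPair ιF hF).1 // σ.1.comp (algebraMap K₀ F) = ψ}) +
        A.dim.choose (Fintype.card {σ : (cmTypeOfPair ιF hF).1 //
          σ.1.comp (algebraMap K₀ F) = ComplexEmbedding.conjugate ψ}) := by
  have key := finrank_traceField_le_choose_add_choose K₀ hK₀ (cmTypeOfPair ιF hF) ψ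
  have hsum := card_fibre_add_card_fibre_conjugate_eq_dim ιF hF K₀ hK₀ ψ
  rw [ncard_inter_fibre_eq_card₇ K₀, finrank_eq_dim₇ hF K₀ hK₀] at key
  have hsub : A.dim - Fintype.card {σ : (cmTypeOfPair ιF hF).1 // σ.1.comp (algebraMap K₀ F) = ψ} =
      Fintype.card {σ : (cmTypeOfPair ιF hF).1 // σ.1.comp (algebraMap K₀ F) = ComplexEmbedding.conjugate ψ} := by
    omega
  rwa [hsub] at key

/-- **Under the `(r, s)`-signature condition: `[K* : ℚ] ≤ C(n, r) + C(n, s)`.** [cite: Dodson1984, §1.3 Remark and §3.1.1 Theorem (proof)]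
[cite: KudlaRapoport2013, §2 (2.1)] [cite: Shimura1998, §8.3 Prop. 28] -/
theorem finrank_traceField_cmTypeOfPair_le_of_charpoly_eq (hK₀ : finrank ℚ K₀ = 2) (ψ : K₀ →+* ℂ) {r s : ℕ}
    (h : ∀ (a : K₀) (u : End A), AbelianVariety.endAlgebra.of A u = ιF (algebraMap K₀ F a) →
      (Motives.AbelianVariety.cotangentMap A u).charpoly =
        (X - C (ψ a : ℂ)) ^ r * (X - C (ComplexEmbedding.conjugate ψ a : ℂ)) ^ s) :
    finrank ℚ (traceField (cmTypeOfPair ιF hF)) ≤ A.dim.choose r + A.dim.choose s := by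
  obtain ⟨h1, h2⟩ := card_fibre_eq_of_charpoly_eq ιF hF K₀ hK₀ ψ h
  have key := finrank_traceField_cmTypeOfPair_le_choose_add_choose ιF hF K₀ hK₀ ψ
  rwa [h1, h2] at key

/-- **Balanced signature `(r, r)`: `[K* : ℚ] ≤ C(2r, r)`.** [cite: Dodson1984, §1.3 Remark and §3.1.1 Theorem (proof)]
[cite: vanGeemen1994HodgeAV, 4.9] -/
theorem finrank_traceField_cmTypeOfPair_le_choose_of_card_fibre_eq (hK₀ : finrank ℚ K₀ = 2) {ψ : K₀ →+* ℂ}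
    (h : Fintype.card {σ : (cmTypeOfPair ιF hF).1 // σ.1.comp (algebraMap K₀ F) = ψ} =
      Fintype.card {σ : (cmTypeOfPair ιF hF).1 // σ.1.comp (algebraMap K₀ F) = ComplexEmbedding.conjugate ψ}) :
    finrank ℚ (traceField (cmTypeOfPair ιF hF)) ≤
      A.dim.choose (Fintype.card {σ : (cmTypeOfPair ιF hF).1 // σ.1.comp (algebraMap K₀ F) = ψ}) := by
  have hsum := card_fibre_add_card_fibre_conjugate_eq_dim ιF hF K₀ hK₀ ψ
  have key := finrank_traceField_le_choose_of_two_mul_eq K₀ hK₀ (cmTypeOfPair ιF hF) ψ (by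
    rw [ncard_inter_fibre_eq_card₇ K₀, finrank_eq_dim₇ hF K₀ hK₀]; omega)
  rwa [ncard_inter_fibre_eq_card₇ K₀, finrank_eq_dim₇ hF K₀ hK₀] at key

/-- The `(r, r)`-condition form: `[K* : ℚ] ≤ C(2r, r)`. [cite: Dodson1984, §1.3 Remark and §3.1.1 Theorem (proof)]
[cite: KudlaRapoport2013, §2 (2.1)] -/
theorem finrank_traceField_cmTypeOfPair_le_choose_of_charpoly_eq (hK₀ : finrank ℚ K₀ = 2) (ψ : K₀ →+* ℂ) {r : ℕ}
    (h : ∀ (a : K₀) (u : End A), AbelianVariety.endAlgebra.of A u = ιF (algebraMap K₀ F a) →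
      (Motives.AbelianVariety.cotangentMap A u).charpoly =
        (X - C (ψ a : ℂ)) ^ r * (X - C (ComplexEmbedding.conjugate ψ a : ℂ)) ^ r) :
    finrank ℚ (traceField (cmTypeOfPair ιF hF)) ≤ (2 * r).choose r := by
  obtain ⟨h1, h2⟩ := card_fibre_eq_of_charpoly_eq ιF hF K₀ hK₀ ψ h
  have hdim : A.dim = 2 * r := by
    have h3 := add_eq_dim_of_charpoly_eq ιF hF K₀ hK₀ ψ h
    omega
  have key := finrank_traceField_cmTypeOfPair_le_choose_of_card_fibre_eq ιF hF K₀ hK₀ (h1.trans h2.symm)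
  rwa [h1, hdim] at key

omit [IsCMField F] in
/-- **Sharpness: under the `(1, n − 1)`-signature condition (`n ≥ 3`), `[K* : ℚ] = 2n = C(n, 1) + C(n, n − 1)`.**
[cite: Howard2012, §3.1] [cite: Dodson1984, §3.1.1 Theorem (proof)] -/
theorem finrank_traceField_cmTypeOfPair_eq_two_mul_dim_of_charpoly_eq (hK₀ : finrank ℚ K₀ = 2) (h3 : 3 ≤ A.dim)
    (ψ : K₀ →+* ℂ)
    (h : ∀ (a : K₀) (u : End A), AbelianVariety.endAlgebra.of A u = ιF (algebraMap K₀ F a) →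
      (Motives.AbelianVariety.cotangentMap A u).charpoly =
        (X - C (ψ a : ℂ)) ^ 1 * (X - C (ComplexEmbedding.conjugate ψ a : ℂ)) ^ (A.dim - 1)) :
    finrank ℚ (traceField (cmTypeOfPair ιF hF)) = 2 * A.dim ∧ 2 * A.dim = A.dim.choose 1 + A.dim.choose (A.dim - 1) := by
  obtain ⟨σ₀, hσ₀, -, hsp⟩ := exists_special_of_charpoly_eq ιF hF K₀ hK₀ ψ h
  refine ⟨finrank_traceField_cmTypeOfPair_eq_of_special ιF hF K₀ hK₀ h3 hσ₀ hsp, ?_⟩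
  rw [Nat.choose_one_right, Nat.choose_symm (by omega : 1 ≤ A.dim), Nat.choose_one_right]
  omega

end EndFieldFullDegree

end Literature.AlgebraicGeometry.ComplexMultiplication

end
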